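import Literature.AlgebraicGeometry.Motives.AbelianSchemeModelTwistedReductionTateHolds
import Literature.AlgebraicGeometry.Motives.AbelianVarietyTateSpecialisationConjFrob
import Literature.AlgebraicGeometry.Motives.AbelianSchemeModelHomReductionConjFrob
import Literature.AlgebraicGeometry.Motives.AbelianSchemeModelTateSpecialisationFamily
import Literature.AlgebraicGeometry.Motives.AbelianVarietyGoodReductionHomConjFrobTate
import Literature.NumberTheory.NumberFields.FrobeniusLiftAlgebraicClosure
import HarnessLib

/-!
# Good reduction of a finite family of abelian varieties with Tate-compatible reductions of homomorphisms and of the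
# Frobenius conjugates — the named fact
# `AbelianVariety.exists_finite_forall_exists_goodReductionAt_homReduction_conjFrob_isTateCompatible` HOLDS

G. Shimura, *Abelian Varieties with Complex Multiplication and Modular Functions* (Princeton 1998), §11.1 Prop. 12 and
Prop. 14 (i), and §18.6, proof of Thm. 18.6 (pp. 128–130: «`(Y^σ)~ = Ỹ^f`»); J.-P. Serre, J. Tate, *Good reduction of abelian
varieties*, Ann. of Math. 88 (1968), §1 Lemma 2 and Thm. 1.  The Literature named fact
`AbelianVariety.exists_finite_forall_exists_goodReductionAt_homReduction_conjFrob_isTateCompatible`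
(`Motives/AbelianVarietyGoodReductionHomConjFrobTate`): for a finite family `A i` of abelian varieties over a number field
`K`, cofinitely in the place `v`, there are good-reduction data `R i` with pairwise Tate-compatible reductions of
homomorphisms, and for every arithmetic Frobenius `γ ∈ Aut(K/F₀)` at `v` (`q = pⁿ`) companions `A i ⇄ (A a)^γ` of the
Frobenius conjugate, a Frobenius `σ̃ ∈ Aut K̄` over `γ`, produced and transported `ℓ`-adic specialisation data with one
common prime, Prop. 14 (i) for the produced pairs, Tate compatibility of the companions, and clause (2′).

* `TwistedReductionAssembly.exists_finite_forall_exists_goodReductionAt_homReduction_conjFrob_isTateCompatible_of_twistedReduction`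
  — the ASSEMBLY from tree theorems (cofinite abelian-scheme models `exists_finite_forall_exists_isAbelianSchemeModel` and
  their produced data `IsAbelianSchemeModel.goodReductionAt` / `homReduction` / `tateSpecialisation`, the companions of the
  Frobenius conjugate `nonempty_homReduction_conjFrob`, the transported specialisation datum `TateSpecialisation.conjFrob`
  with clause (2′), the Frobenius lift `exists_algEquiv_algebraicClosure_lift_of_isArithFrobAt`), GIVEN the one geometric
  input «Q5»: Tate compatibility of the companion pair data with the produced/transported specialisation data
  (hypothesis `hQ5`, stated inline; it is, token for token, the named fact
  `IsAbelianSchemeModel.forall_isTateCompatible_homReduction_conjFrob_tateSpecialisation`, `q5_iff`);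
* **`Literature.AlgebraicGeometry.Motives.AbelianVariety.exists_finite_forall_exists_goodReductionAt_homReduction_conjFrob_isTateCompatible_holds`**
  — the named fact, PROVED under its exact name: the assembly at the proved Q5
  (`IsAbelianSchemeModel.forall_isTateCompatible_homReduction_conjFrob_tateSpecialisation_holds`,
  `Motives/AbelianSchemeModelTwistedReductionTateHolds`).

Theorems only: no definition, no NEW named fact (net: one Literature named fact discharged under its exact name).

Provenance: Literature home (namespace `Literature.AlgebraicGeometry.Motives.AbelianVariety.TwistedReductionAssembly`) of the
Summits-side `HodgeConjecture/Theorems/HCCMUnconditionalS5cPrimeOfTwistedReduction`, `CorCM/Hyp21/S5cPrimeOfQ5` and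
`HodgeConjecture/Theorems/HCCMUnconditionalS5cPrimeHolds` (cell `hodgecm-mathlib`, row II-1, edition E4; imports `Literature/`
and Mathlib only), which `Literature/` may not import. Lane `lit-hodgefound`, seat p20.

## References

* [Shimura1998] G. Shimura, *Abelian Varieties with Complex Multiplication and Modular Functions*, Princeton Univ. Press
  1998: §11.1 Prop. 12 and Prop. 14 (i) (p. 85); §18.6 proof of Thm. 18.6 (pp. 128–130); §19.4 (19.4a).
* [SerreTate1968] J.-P. Serre, J. Tate, *Good reduction of abelian varieties*, Ann. of Math. 88 (1968), §1 Lemma 2,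
  Thm. 1.
-/

set_option autoImplicit false

noncomputable section

open CategoryTheory AlgebraicGeometry IsDedekindDomain IsDedekindDomain.HeightOneSpectrum
open scoped NumberField
open Literature.NumberTheory.EllipticCurves Literature.NumberTheory.GaloisRepresentations
open Literature.NumberTheory.DiophantineGeometry Literature.NumberTheory.NumberFields
open Literature.AlgebraicGeometry.Motives Literature.AlgebraicGeometry.Motives.AbelianVariety

namespace Literature.AlgebraicGeometry.Motives.AbelianVariety.TwistedReductionAssembly

/-- (σ-b) bookkeeping: `(ℓᵐ : 𝓞 F₀) ∉ v ∩ 𝓞 F₀` from `(ℓ : 𝓞 K) ∉ v`.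
[cite: Shimura1998, §18.6 proof of Thm. 18.6 (pp. 128–130)] -/
private theorem natCast_pow_not_mem_under {F₀ K : Type} [Field F₀] [Field K] [NumberField K] [Algebra F₀ K]
    {v : HeightOneSpectrum (𝓞 K)} {ℓ : ℕ} (hℓv : (ℓ : 𝓞 K) ∉ v.asIdeal) (m : ℕ) :
    ((ℓ ^ m : ℕ) : 𝓞 F₀) ∉ v.asIdeal.under (𝓞 F₀) := by
  intro hmem
  rw [Ideal.under_def, Ideal.mem_comap, map_natCast, Nat.cast_pow] at hmem
  exact hℓv (v.isPrime.mem_of_pow_mem m hmem)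


/-- **`S5c′` from Q5 alone.**  If, for every pair of abelian-scheme models `hi, ha` at `v`, every arithmetic Frobenius
`γ ∈ Aut(K/F₀)` at `v` with `q = pⁿ`, every `σ̃ ∈ Aut K̄` over `γ` congruent to the `q`-power map modulo the produced prime,
and every `ℓ ∤ v`, ALL companion pair data `Hγ : A i → (A a)^γ`, `Hγ′ : (A a)^γ → A i` between the produced good-reduction
datum and the Frobenius-conjugate datum are Tate-compatible with the produced specialisation datum
`hi.tateSpecialisation ℓ hℓv` and the TRANSPORTED one `(ha.tateSpecialisation ℓ hℓv).conjFrob γ hγ p n hq σ̃ …`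
(hypothesis `hQ5` — [Shimura1998] §18.6 p. 129 «`(Y^σ)~ = Ỹ^f`» read on Tate modules; the named fact
`IsAbelianSchemeModel.forall_isTateCompatible_homReduction_conjFrob_tateSpecialisation`, `q5_iff` below), then `S5c′` holds: every other
clause is a tree theorem (spreading out, `R i := (h i).goodReductionAt`, `H := homReduction`, `T i := tateSpecialisation`,
one common prime `adicCompletionPrime K v`, Prop. 14 (i) for produced pairs, the companions, `σ̃` with (σ-a)/(σ-b), the
transported `Tγ` and clause (2′)).
[cite: Shimura1998, §11.1 Prop. 12 and Prop. 14 (i); §18.6 proof of Thm. 18.6 (pp. 128–130); §19.4 (19.4a)]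
[cite: SerreTate1968, §1 Lemma 2 and Thm. 1] -/
theorem exists_finite_forall_exists_goodReductionAt_homReduction_conjFrob_isTateCompatible_of_twistedReduction
    (hQ5 : ∀ {F₀ K : Type} [Field F₀] [Field K] [NumberField K] [Algebra F₀ K] {v : HeightOneSpectrum (𝓞 K)}
      {Aᵢ Aₐ : AbelianVariety K} {𝒜ᵢ 𝒜ₐ : SchemeOver (valuationSubringAtPrime K v)} [GrpObj 𝒜ᵢ] [GrpObj 𝒜ₐ]
      (hi : IsAbelianSchemeModel Aᵢ v 𝒜ᵢ) (ha : IsAbelianSchemeModel Aₐ v 𝒜ₐ) (γ : K ≃ₐ[F₀] K)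
      (hγ : IsArithFrobAt (𝓞 F₀) γ v.asIdeal) (p n : ℕ) [ExpChar v.asIdeal.ResidueField p]
      (hq : Nat.card (𝓞 F₀ ⧸ v.asIdeal.under (𝓞 F₀)) = p ^ n)
      (σt : AlgebraicClosure K ≃+* AlgebraicClosure K)
      (hσa : ∀ a : K, σt (algebraMap K (AlgebraicClosure K) a) = algebraMap K (AlgebraicClosure K) (γ.toRingEquiv a))
      (ℓ : ℕ) [Fact ℓ.Prime] (hℓv : ((ℓ : ℕ) : 𝓞 K) ∉ v.asIdeal)
      (hσ𝔓 : ∀ x : absIntegers (𝓞 K) K, ∃ hx : σt x ∈ absIntegers (𝓞 K) K,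
        (⟨σt x, hx⟩ : absIntegers (𝓞 K) K) - x ^ Nat.card (𝓞 F₀ ⧸ v.asIdeal.under (𝓞 F₀)) ∈
          (ha.tateSpecialisation ℓ hℓv).prime)
      (Hγ : GoodReductionAt.HomReduction hi.goodReductionAt (ha.goodReductionAt.conjFrob γ hγ p n hq))
      (Hγ' : GoodReductionAt.HomReduction (ha.goodReductionAt.conjFrob γ hγ p n hq) hi.goodReductionAt),
      Hγ.IsTateCompatible (hi.tateSpecialisation ℓ hℓv)
          ((ha.tateSpecialisation ℓ hℓv).conjFrob γ hγ p n hq σt hσa hσ𝔓) ∧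
        Hγ'.IsTateCompatible ((ha.tateSpecialisation ℓ hℓv).conjFrob γ hγ p n hq σt hσa hσ𝔓)
          (hi.tateSpecialisation ℓ hℓv)) :
    AbelianVariety.exists_finite_forall_exists_goodReductionAt_homReduction_conjFrob_isTateCompatible := by
  intro K _ _ ι _ A
  classical
  -- spreading out: abelian-scheme models of every member outside a finite set of places
  choose S hS hmod using fun i => exists_finite_forall_exists_isAbelianSchemeModel (A i)
  refine ⟨⋃ i, S i, Set.finite_iUnion hS, fun v hv => ?_⟩
  have hv' : ∀ i, v ∉ S i := fun i hvi => hv (Set.mem_iUnion.mpr ⟨i, hvi⟩)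
  choose 𝒜 inst h using fun i => hmod i v (hv' i)
  -- the produced data `R i`, `H i j`
  refine ⟨fun i => (h i).goodReductionAt, fun i j => (h i).homReduction (h j), ?_⟩
  intro F₀ _ _ _ a γ hγ p n _ hq
  -- the companions of the Frobenius conjugate
  refine ⟨fun i => Classical.choice ((h i).nonempty_homReduction_conjFrob (h a) γ hγ p n hq).1,
    fun i => Classical.choice ((h i).nonempty_homReduction_conjFrob (h a) γ hγ p n hq).2, fun ℓ _ => ?_⟩
  intro hℓv
  -- the Frobenius `σ̃ ∈ Aut(K̄/F₀)` over `γ` at the produced prime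
  obtain ⟨σt, hσa, hσ𝔓, hσb⟩ := exists_algEquiv_algebraicClosure_lift_of_isArithFrobAt γ v hγ
    ((h a).tateSpecialisation ℓ hℓv).prime_mem
  have hσa' : ∀ x : K, σt.toRingEquiv (algebraMap K (AlgebraicClosure K) x) =
      algebraMap K (AlgebraicClosure K) (γ.toRingEquiv x) := hσa
  have hσ𝔓' : ∀ x : absIntegers (𝓞 K) K, ∃ hx : σt.toRingEquiv x ∈ absIntegers (𝓞 K) K,
      (⟨σt.toRingEquiv x, hx⟩ : absIntegers (𝓞 K) K) - x ^ Nat.card (𝓞 F₀ ⧸ v.asIdeal.under (𝓞 F₀)) ∈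
        ((h a).tateSpecialisation ℓ hℓv).prime := hσ𝔓
  refine ⟨fun i => (h i).tateSpecialisation ℓ hℓv,
    ((h a).tateSpecialisation ℓ hℓv).conjFrob γ hγ p n hq σt.toRingEquiv hσa' hσ𝔓', σt.toRingEquiv, hσa',
    ?_, ?_, ?_, ?_, ?_, ?_, ?_⟩
  · -- (σ-b): `σ̃ ζ = ζ^q` on `ℓ`-power roots of unity
    intro m ζ hζ
    rw [← hq]
    exact hσb (ℓ ^ m) (natCast_pow_not_mem_under hℓv m) ζ hζ
  · -- one common prime
    intro i j
    rw [IsAbelianSchemeModel.tateSpecialisation_prime, IsAbelianSchemeModel.tateSpecialisation_prime]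
  · intro i
    rw [GoodReductionAt.TateSpecialisation.conjFrob_prime, IsAbelianSchemeModel.tateSpecialisation_prime,
      IsAbelianSchemeModel.tateSpecialisation_prime]
  · -- Prop. 14 (i) for the produced pairs
    exact fun i j => (h i).isTateCompatible_homReduction_tateSpecialisation (h j) ℓ hℓv
  · -- Q5
    exact fun i => (hQ5 (h i) (h a) γ hγ p n hq σt.toRingEquiv hσa' ℓ hℓv hσ𝔓'
      (Classical.choice ((h i).nonempty_homReduction_conjFrob (h a) γ hγ p n hq).1)
      (Classical.choice ((h i).nonempty_homReduction_conjFrob (h a) γ hγ p n hq).2)).1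
  · -- Q5′
    exact fun i => (hQ5 (h i) (h a) γ hγ p n hq σt.toRingEquiv hσa' ℓ hℓv hσ𝔓'
      (Classical.choice ((h i).nonempty_homReduction_conjFrob (h a) γ hγ p n hq).1)
      (Classical.choice ((h i).nonempty_homReduction_conjFrob (h a) γ hγ p n hq).2)).2
  · -- clause (2′) for the transported datum
    intro m x x' hx'
    exact GoodReductionAt.TateSpecialisation.conjFrob_reductionTorsionEquiv ((h a).tateSpecialisation ℓ hℓv) γ hγ p n
      hq σt.toRingEquiv hσa' hσ𝔓' hℓv m x x' hx'


/-- **Token-faithfulness**: the named fact Q5 `IsAbelianSchemeModel.forall_isTateCompatible_homReduction_conjFrob_tateSpecialisation`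
unfolds, by `Iff.rfl`, to the hypothesis `hQ5` of the assembly above. [cite: Shimura1998, §18.6 proof of Thm. 18.6 (pp. 128–130)] -/
theorem q5_iff : IsAbelianSchemeModel.forall_isTateCompatible_homReduction_conjFrob_tateSpecialisation ↔
    ∀ {F₀ K : Type} [Field F₀] [Field K] [NumberField K] [Algebra F₀ K] {v : HeightOneSpectrum (𝓞 K)}
      {Aᵢ Aₐ : AbelianVariety K} {𝒜ᵢ 𝒜ₐ : SchemeOver (valuationSubringAtPrime K v)} [GrpObj 𝒜ᵢ] [GrpObj 𝒜ₐ]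
      (hi : IsAbelianSchemeModel Aᵢ v 𝒜ᵢ) (ha : IsAbelianSchemeModel Aₐ v 𝒜ₐ) (γ : K ≃ₐ[F₀] K)
      (hγ : IsArithFrobAt (𝓞 F₀) γ v.asIdeal) (p n : ℕ) [ExpChar v.asIdeal.ResidueField p]
      (hq : Nat.card (𝓞 F₀ ⧸ v.asIdeal.under (𝓞 F₀)) = p ^ n)
      (σt : AlgebraicClosure K ≃+* AlgebraicClosure K)
      (hσa : ∀ a : K, σt (algebraMap K (AlgebraicClosure K) a) = algebraMap K (AlgebraicClosure K) (γ.toRingEquiv a))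
      (ℓ : ℕ) [Fact ℓ.Prime] (hℓv : ((ℓ : ℕ) : 𝓞 K) ∉ v.asIdeal)
      (hσ𝔓 : ∀ x : absIntegers (𝓞 K) K, ∃ hx : σt x ∈ absIntegers (𝓞 K) K,
        (⟨σt x, hx⟩ : absIntegers (𝓞 K) K) - x ^ Nat.card (𝓞 F₀ ⧸ v.asIdeal.under (𝓞 F₀)) ∈
          (ha.tateSpecialisation ℓ hℓv).prime)
      (Hγ : GoodReductionAt.HomReduction hi.goodReductionAt (ha.goodReductionAt.conjFrob γ hγ p n hq))
      (Hγ' : GoodReductionAt.HomReduction (ha.goodReductionAt.conjFrob γ hγ p n hq) hi.goodReductionAt),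
      Hγ.IsTateCompatible (hi.tateSpecialisation ℓ hℓv)
          ((ha.tateSpecialisation ℓ hℓv).conjFrob γ hγ p n hq σt hσa hσ𝔓) ∧
        Hγ'.IsTateCompatible ((ha.tateSpecialisation ℓ hℓv).conjFrob γ hγ p n hq σt hσa hσ𝔓)
          (hi.tateSpecialisation ℓ hℓv) :=
  Iff.rfl

/-- **The named fact `AbelianVariety.exists_finite_forall_exists_goodReductionAt_homReduction_conjFrob_isTateCompatible`
HOLDS** ([Shimura1998] §11.1 Prop. 12 / Prop. 14 (i) and §18.6 p. 129, merged produced-currency form; exact name): the assembly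
`exists_finite_forall_exists_goodReductionAt_homReduction_conjFrob_isTateCompatible_of_twistedReduction` at the proved input Q5
`IsAbelianSchemeModel.forall_isTateCompatible_homReduction_conjFrob_tateSpecialisation_holds`.
[cite: Shimura1998, §11.1 Prop. 12 and Prop. 14 (i); §18.6 proof of Thm. 18.6 (pp. 128–130)] [cite: SerreTate1968, §1 Lemma 2 and Thm. 1] -/
theorem _root_.Literature.AlgebraicGeometry.Motives.AbelianVariety.exists_finite_forall_exists_goodReductionAt_homReduction_conjFrob_isTateCompatible_holds :
    AbelianVariety.exists_finite_forall_exists_goodReductionAt_homReduction_conjFrob_isTateCompatible :=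
  exists_finite_forall_exists_goodReductionAt_homReduction_conjFrob_isTateCompatible_of_twistedReduction
    IsAbelianSchemeModel.forall_isTateCompatible_homReduction_conjFrob_tateSpecialisation_holds

end Literature.AlgebraicGeometry.Motives.AbelianVariety.TwistedReductionAssembly

end
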